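/-
Copyright: the b2b-balaban cell (near-miss cell 7), T⁴-continuum fan-out; row NE7b ROUND-2 swarm, seat
t4-ne7b-formalise-leaf-02 gen 4 (row S6g′ instance sub-piece «INST-SUP» of `t4/b2b-balaban-t4-ne7b-p1/LEAVES-NE7b.md`,
leaf-05 gen 2's `INSTANCE-RECIPE.md` §3: the extent law from linkedness × mass).
Released under the licence of the surrounding project.
-/
import Summits.QuantumFields.BalabanUV.T4Continuum.Support.HistoryJoinsSup
import Summits.QuantumFields.BalabanUV.T4Continuum.Support.HistoryZoneMass

/-!
# History joins, suprema — part 3: THE EXTENT LAW PER PLACEMENT FROM LINKEDNESS × CARDINALITY (row S6g′, INST-SUP)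

Summits-side support leaf of the T⁴-continuum cell (rung (B)+1 on a FINITE torus only; NOT infinite volume, NOT the
mass gap, NOT the Clay statement; NOT a proof of the spine estimate NE7b).  Row NE7b, route «COUNT»; row S6g′.
[folklore] finite torus geometry and bookkeeping over the lineage's own carriers (`ZoneTorus.cdist`,
`HistoryZoneMass.Linked`, `HistoryJoinsSup.extsup`); nothing is quoted from print, nothing printed is asserted, no
`[cite:]` tag, no `Prop` fact of Bałaban's.

WHAT.  Part 1's `MρP_sup_le_exp_bsum` leaves the END's radius input `hMρP` as the PER-PLACEMENT EXTENT LAW at the joins: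
every block `u` of the zone of an admissibly placed part `P` at a join `X` (`t = ftime X`) has witness radius
`δ u t (root cell) (rootStep P) ≤ C₁·zmass … t P + c₁`.  On the torus the witness radius is a cyclic sup-DISTANCE between
the block `u` and the root cell's level-`t` block (`radT m blk u t y s := cdist (m t) u (blk t y)`), and the law is
LINKEDNESS × CARDINALITY:
* §1 **`cdist_le_of_linked`**: a `ρ`-linked set `S` of block vectors in range has `cdist m u v ≤ ρ·(#S − 1)` for all
  `u, v ∈ S` — two members are joined INSIDE `S` by a chain without repetitions (a path of the link graph `linkGraph m ρ S`,
  fewer than `#S` steps by `SimpleGraph.Walk.IsPath.length_lt`), each step of length `≤ ρ` (`cdist_triangle`);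
  `diam_le_of_linked`;
* §2 **`radT_le_of_linked`**: if the zone is in range, `ρ`-linked, contains the root cell's block and has `#zone ≤ φ + γ′`,
  then every block of it has `radT ≤ ρ·φ + ρ·γ′`; hence **`hlawE_of_linked`** — part 1 §5's binder `hlawE` with
  `C₁ := ρ`, `c₁ := ρ·γ′` from four PER-PLACEMENT READING facts at the joins (in range, linked, root block inside,
  cardinality law — asked of NONEMPTY zones only), and the END's input **`MρP_sup_le_exp_bsum_of_linked`**.

The four reading facts are rows (a)∕S6's: `HistoryZoneMassRegions.linked_regZoneD` ∕ `inRange_coreZoneD` (leaf-04 gen 3,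
leaf-07 gen 2's `BirthRegionsD`), the root block inside the zone (the zone reading's root clause), and the cardinality law
`card_regZoneD_le` — the same law part 1's `MS_sup_le_bsum` consumes; composing them on the address-tagged tree
(`HistoryJoinsTag`, leaf-05 gen 2) is the instance seat's, not this file's.

HONEST SCOPE.  Geometry∕bookkeeping over OUR carriers with displayed reading facts; nothing of print; `BirthShapeNodup`
NOT retired; NE7b NOT proved; spine 0∕9.  HONEST DEPENDENCY (cell): continuum YM on T⁴ ⇐ BetaPertH ∧ nine spine
estimates (0/9 proved); BetaPertH ⇐ (D1) ∧ (D4) ∧ CAP+tail; G-an2-4 gates asym, D1 and NE2/3/4.  This file changes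
none of it.
-/

open Finset
open Literature.MathematicalPhysics.QuantumFieldTheory.Balaban1983to89
open T4PersistenceDictionary T4PartnerMultiplicity T4BranchingRecordsGas
open Summit.QuantumFields.BalabanUV.T4Continuum.HistoryJoins
open Summit.QuantumFields.BalabanUV.T4Continuum.HistoryJoinsAdm
open Summit.QuantumFields.BalabanUV.T4Continuum.HistoryJoinsBudget
open Summit.QuantumFields.BalabanUV.T4Continuum.HistoryJoinsSup
open Summit.QuantumFields.BalabanUV.T4Continuum.ZoneTorus
open Summit.QuantumFields.BalabanUV.T4Continuum.ZoneSkeleton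
open Summit.QuantumFields.BalabanUV.T4Continuum.HistoryZones
open Summit.QuantumFields.BalabanUV.T4Continuum.HistoryZoneMass
open Summit.QuantumFields.BalabanUV.T4Continuum.HistoryZoneMassJoins
open Summit.QuantumFields.BalabanUV.T4Continuum.HistoryZoneMassLaw

namespace Summit.QuantumFields.BalabanUV.T4Continuum.HistoryJoinsSupExtent

noncomputable section

variable {d : ℕ}

/-! ## §1 A linked set has diameter at most `ρ·(#S − 1)` -/

/-- the LINK GRAPH of a set of block vectors: two members at cyclic sup-distance `≤ ρ` are adjacent [folklore] -/
def linkGraph (m ρ : ℕ) (S : Finset (Fin d → ℕ)) : SimpleGraph S :=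
  SimpleGraph.fromRel fun a b : S => cdist m a.1 b.1 ≤ ρ

/-- a linked set is a connected link graph: every two members are reachable [folklore] -/
theorem reachable_of_linked {m ρ : ℕ} {S : Finset (Fin d → ℕ)} (hl : Linked m ρ S) {u v : Fin d → ℕ}
    (hu : u ∈ S) (hv : v ∈ S) : (linkGraph m ρ S).Reachable ⟨u, hu⟩ ⟨v, hv⟩ := by
  have h := hl u hu v hv
  revert hv
  induction h with
  | refl => intro _; exact SimpleGraph.Reachable.refl _
  | @tail b c _ hbc ih =>
      intro hc
      by_cases heq : b = c
      · subst heq; exact ih hc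
      · refine (ih hbc.1).trans (SimpleGraph.Adj.reachable ?_)
        rw [linkGraph, SimpleGraph.fromRel_adj]
        exact ⟨fun h => heq (congrArg Subtype.val h), Or.inl hbc.2.2⟩

/-- along a walk of the link graph the distance grows by at most `ρ` per step (`cdist_triangle`) [folklore] -/
theorem cdist_le_mul_length {m ρ : ℕ} {S : Finset (Fin d → ℕ)} (hS : InRange m S) :
    ∀ {x y : S} (p : (linkGraph m ρ S).Walk x y), cdist m x.1 y.1 ≤ ρ * p.length
  | _, _, SimpleGraph.Walk.nil => by rw [cdist_self]; exact Nat.zero_le _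
  | x, y, SimpleGraph.Walk.cons (v := w) hadj q => by
      have h1 : cdist m x.1 w.1 ≤ ρ := by
        rw [linkGraph, SimpleGraph.fromRel_adj] at hadj
        rcases hadj.2 with h | h
        · exact h
        · rw [cdist_comm]; exact h
      have h2 := cdist_le_mul_length hS q
      rw [SimpleGraph.Walk.length_cons]
      calc cdist m x.1 y.1 ≤ cdist m x.1 w.1 + cdist m w.1 y.1 := cdist_triangle (hS _ x.2) (hS _ w.2) (hS _ y.2)
        _ ≤ ρ + ρ * q.length := add_le_add h1 h2
        _ = ρ * (q.length + 1) := by ring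

/-- **A `ρ`-LINKED SET OF `N` BLOCK VECTORS IN RANGE HAS DIAMETER AT MOST `ρ·(N − 1)`**: any two members are joined
INSIDE the set by a chain without repetitions (a path of the link graph: fewer than `N` steps), each step of cyclic
sup-length `≤ ρ`. [folklore] -/
theorem cdist_le_of_linked {m ρ : ℕ} {S : Finset (Fin d → ℕ)} (hS : InRange m S) (hl : Linked m ρ S)
    {u v : Fin d → ℕ} (hu : u ∈ S) (hv : v ∈ S) : cdist m u v ≤ ρ * (S.card - 1) := by
  classical
  obtain ⟨p⟩ := reachable_of_linked hl hu hv
  have hlen : p.toPath.1.length < Fintype.card S := p.toPath.2.length_lt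
  have h := cdist_le_mul_length (ρ := ρ) hS p.toPath.1
  rw [Fintype.card_coe] at hlen
  exact h.trans (Nat.mul_le_mul_left _ (by omega))

/-- … the diameter form (`ZoneTorus.diam`) [folklore] -/
theorem diam_le_of_linked {m ρ : ℕ} {S : Finset (Fin d → ℕ)} (hS : InRange m S) (hl : Linked m ρ S) :
    diam m S ≤ ρ * (S.card - 1) :=
  diam_le_iff.2 fun _ hu _ hv => cdist_le_of_linked hS hl hu hv

/-- … the real form against a real majorant of the cardinality: `cdist m z u ≤ ρ·x − ρ ≤ ρ·x` for `#S ≤ x` [folklore] -/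
theorem cdist_le_of_linked_real {m ρ : ℕ} {S : Finset (Fin d → ℕ)} (hS : InRange m S) (hl : Linked m ρ S)
    {z u : Fin d → ℕ} (hz : z ∈ S) (hu : u ∈ S) {x : ℝ} (hx : (S.card : ℝ) ≤ x) :
    (cdist m z u : ℝ) ≤ ρ * x := by
  have h := cdist_le_of_linked hS hl hz hu
  have h1 : ((cdist m z u : ℕ) : ℝ) ≤ (ρ : ℝ) * ((S.card - 1 : ℕ) : ℝ) := by exact_mod_cast h
  have hc : 1 ≤ S.card := card_pos.2 ⟨z, hz⟩
  have h2 : ((S.card - 1 : ℕ) : ℝ) = (S.card : ℝ) - 1 := by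
    rw [Nat.cast_sub hc, Nat.cast_one]
  rw [h2] at h1
  have hρ : (0 : ℝ) ≤ ρ := Nat.cast_nonneg _
  nlinarith

/-! ## §2 The witness radius of the torus and the extent law per placement -/

section Extent

variable {ε γ R : Type*} [LinearOrder R] [Fintype γ] {D : ℕ}
  (zone : ℕ → Gen ε → (Addr D → γ) → Finset (Fin d → ℕ)) (ρ : (Addr D → γ) → R) (c₀ : γ) (st : ε → ℕ)
  (m : ℕ → ℕ) (blk : ℕ → γ → (Fin d → ℕ))

/-- **THE WITNESS RADIUS ON THE TORUS**: the cyclic sup-distance, on the level-`t` torus of side `m t`, between the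
block `u` and the level-`t` block `blk t y` of the cell `y` (the scale `s` is not read). [folklore] -/
def radT : (Fin d → ℕ) → ℕ → γ → ℕ → ℝ := fun u t y _ => (cdist (m t) u (blk t y) : ℝ)

omit [LinearOrder R] [Fintype γ] in
/-- the witness radius is nonnegative [folklore] -/
theorem radT_nonneg (u : Fin d → ℕ) (t : ℕ) (y : γ) (s : ℕ) : 0 ≤ radT m blk u t y s := Nat.cast_nonneg _

omit [Fintype γ] in
/-- **THE EXTENT LAW OF ONE PLACED ZONE FROM LINKEDNESS × CARDINALITY**: a zone in range, `ρℓ`-linked, containing the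
root cell's block, of cardinality `≤ φ + γ′`, keeps every block within `ρℓ·φ + ρℓ·γ′` of the root block. [folklore] -/
theorem radT_le_of_linked {ρℓ : ℕ} {t : ℕ} {Z : Gen ε} {p : Addr D → γ} {φ γ' : ℝ}
    (hR : InRange (m t) (zone t Z p)) (hL : Linked (m t) ρℓ (zone t Z p))
    (hroot : blk t (evalA c₀ p (rootAddr Z)) ∈ zone t Z p) (hcard : ((zone t Z p).card : ℝ) ≤ φ + γ')
    {u : Fin d → ℕ} (hu : u ∈ zone t Z p) :
    radT m blk u t (evalA c₀ p (rootAddr Z)) Z.rootStep ≤ ρℓ * φ + ρℓ * γ' := by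
  have h := cdist_le_of_linked_real hR hL hu hroot hcard
  simp only [radT]
  linarith

variable [DecidableEq ε] (sh : ε → PEv)

omit [DecidableEq ε] in
/-- **PART 1 §5's BINDER `hlawE` FROM FOUR PER-PLACEMENT READING FACTS AT THE JOINS** (in range, linked with radius `ρℓ`,
root block inside, cardinality law in `zmass` currency — asked only of NONEMPTY zones, so a zone map guarded to `∅` off
the reading's regime meets them vacuously): `C₁ := ρℓ`, `c₁ := ρℓ·γ′`. [folklore] -/
theorem hlawE_of_linked {ρℓ : ℕ} {θ WB WM γ' : ℝ} {G : Gen ε}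
    (hfacts : ∀ X ∈ joins (PEv.step ∘ sh) G, ∀ P ∈ tparts (PEv.step ∘ sh) X,
      ∀ p ∈ Sany zone ρ c₀ (PEv.step ∘ sh) P, (zone (ftime (PEv.step ∘ sh) X) P p).Nonempty →
        InRange (m (ftime (PEv.step ∘ sh) X)) (zone (ftime (PEv.step ∘ sh) X) P p) ∧
        Linked (m (ftime (PEv.step ∘ sh) X)) ρℓ (zone (ftime (PEv.step ∘ sh) X) P p) ∧
        blk (ftime (PEv.step ∘ sh) X) (evalA c₀ p (rootAddr P)) ∈ zone (ftime (PEv.step ∘ sh) X) P p ∧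
        ((zone (ftime (PEv.step ∘ sh) X) P p).card : ℝ) ≤ zmass sh θ WB WM (ftime (PEv.step ∘ sh) X) P + γ') :
    ∀ X ∈ joins (PEv.step ∘ sh) G, ∀ P ∈ tparts (PEv.step ∘ sh) X,
      ∀ p ∈ Sany zone ρ c₀ (PEv.step ∘ sh) P, ∀ u ∈ zone (ftime (PEv.step ∘ sh) X) P p,
        radT m blk u (ftime (PEv.step ∘ sh) X) (evalA c₀ p (rootAddr P)) P.rootStep ≤
          (ρℓ : ℝ) * zmass sh θ WB WM (ftime (PEv.step ∘ sh) X) P + ρℓ * γ' := by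
  intro X hX P hP p hp u hu
  obtain ⟨hR, hL, hroot, hcard⟩ := hfacts X hX P hP p hp ⟨u, hu⟩
  exact radT_le_of_linked zone c₀ m blk hR hL hroot hcard hu

/-- **THE END's RADIUS INPUT `hMρP` FOR `ext := extsup … (radT m blk)` FROM LINKEDNESS × CARDINALITY**:
`MρP ≤ exp((2(a + d′·ρℓγ′) + d′·ρℓ·(WB + WM)∕(1 − θ))·F)` under the four per-placement reading facts at the joins,
`Dated`∕`Chrono`, the exponential type of `Mρ` and the signs. [folklore] -/
theorem MρP_sup_le_exp_bsum_of_linked (Mρ : ℝ → ℝ) {a d' : ℝ} (ha : 0 ≤ a) (hd : 0 ≤ d') (hMρ0 : ∀ r, 0 ≤ Mρ r)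
    (hMρ : ∀ r, 0 ≤ r → Mρ r ≤ Real.exp (a + d' * r)) {ρℓ : ℕ}
    {θ WB WM γ' : ℝ} (hθ0 : 0 ≤ θ) (hθ1 : θ < 1) (hB : 0 ≤ WB) (hM : 0 ≤ WM) (hγ : 0 ≤ γ')
    {G : Gen ε} {T : ℕ} (hD : Dated (PEv.step ∘ sh) true T G) (hC : Chrono (PEv.step ∘ sh) G)
    (hfacts : ∀ X ∈ joins (PEv.step ∘ sh) G, ∀ P ∈ tparts (PEv.step ∘ sh) X,
      ∀ p ∈ Sany zone ρ c₀ (PEv.step ∘ sh) P, (zone (ftime (PEv.step ∘ sh) X) P p).Nonempty →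
        InRange (m (ftime (PEv.step ∘ sh) X)) (zone (ftime (PEv.step ∘ sh) X) P p) ∧
        Linked (m (ftime (PEv.step ∘ sh) X)) ρℓ (zone (ftime (PEv.step ∘ sh) X) P p) ∧
        blk (ftime (PEv.step ∘ sh) X) (evalA c₀ p (rootAddr P)) ∈ zone (ftime (PEv.step ∘ sh) X) P p ∧
        ((zone (ftime (PEv.step ∘ sh) X) P p).card : ℝ) ≤ zmass sh θ WB WM (ftime (PEv.step ∘ sh) X) P + γ') :
    MρP (PEv.step ∘ sh) (extsup zone ρ c₀ (PEv.step ∘ sh) (radT m blk)) Mρ G ≤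
      Real.exp ((2 * (a + d' * (ρℓ * γ')) + d' * ρℓ * ((WB + WM) / (1 - θ))) *
        bsum (fun b => (((sh b).fat : ℕ) : ℝ) + 1) G) :=
  MρP_sup_le_exp_bsum zone ρ c₀ (radT m blk) sh Mρ ha hd hMρ0 hMρ (Nat.cast_nonneg ρℓ) (mul_nonneg (Nat.cast_nonneg ρℓ) hγ)
    hθ0 hθ1 hB hM hD hC (hlawE_of_linked zone ρ c₀ m blk sh hfacts)

end Extent

end

end Summit.QuantumFields.BalabanUV.T4Continuum.HistoryJoinsSupExtent
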